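import Mathlib
import HarnessLib
import Literature.MathematicalPhysics.StatisticalMechanics.TorusFiniteRangeDecomposition
import Literature.MathematicalPhysics.StatisticalMechanics.RelevantHamiltonians
import Literature.MathematicalPhysics.StatisticalMechanics.TaylorPolynomialNorms
import Literature.MathematicalPhysics.StatisticalMechanics.TaylorPolynomialNormsPullback

/-!
# The lattice field gauges `|ξ|_{j,X}` of the gradient renormalisation group
# (Adams–Buchholz–Kotecký–Müller, Ch. 6.4 (6.40)–(6.41) and App. A.5 "Main example")

The `T_φ` norms of the multiscale analysis of gradient models on the torus `(ℤ/L^N)^d`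
([ABKM19] Ch. 6.4; `TaylorPolynomialNorms.lean`) are dual to the FIELD GAUGE
`|ξ|_{j,X} = max_{x ∈ X*} max_{1 ≤ |α| ≤ p_Φ} w_j(α)⁻¹ |∇^α ξ(x)|`, `∇^α = Π_i ∇_i^{α_i}`
(forward differences), with the weights `w_j(α) = h_j L^{-j|α|} L^{-j(d-2)/2}`, `h_j = 2^j h`
([ABKM19] (6.40)–(6.41); one component `m = 1`).  Writing `w_j(α)⁻¹ = 𝔥⁻¹ R^{|α|}` with
`𝔥 = h_j L^{-j(d-2)/2}`, `R = L^j`, the gauge is the linear map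
`ξ ↦ (𝔥⁻¹ R^{|α|} ∇^α ξ(x))_{(x,α) ∈ S × {1 ≤ |α| ≤ p}}` into the sup-normed space
`(S × {α}) → ℝ`, for a finite set of sites `S` (in the source `S = X*`, the small-set neighbourhood
of the polymer `X`).  It is only a seminorm on fields: constants and fields whose gradients vanish
on `S` have gauge `0` ("for an element `φ ∈ 𝒳` we cannot define a pointwise value `φ(x)` but the
derivatives `∇^α φ(x)` are well defined if `α ≠ 0`", App. A.5).

## Contents (everything is proved; no named fact)
* `diffIndex d p` — the multi-indices `α : Fin d → ℕ` with `1 ≤ |α|₁ ≤ p`; `iterDiff_smul`,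
  `iterDiff_single` (`∇^{e_i} = ∇_i`), `iterDiffₗ` (`∇^α` as a linear map);
* **`fieldGauge 𝔥 R p S`** — the gauge `T_{j,S}` above as an `ℝ`-linear map, and the component
  bounds `abs_iterDiff_le_gauge` (`|∇^α ξ(x)| ≤ 𝔥 R^{-|α|} ‖T ξ‖` for `x ∈ S`),
  `gradAt x` (`ξ ↦ (∇_i ξ(x))_i ∈ ℝ^d`) with `norm_gradAt_le_gauge` (`‖∇ξ(x)‖_∞ ≤ (𝔥/R) ‖T ξ‖`);
* `norm_fieldGauge_mono_set`, `norm_fieldGauge_mono_weights` and the dual statements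
  `tayNorm_fieldGauge_anti_set`, `tayNorm_fieldGauge_anti_weights` — more sites / smaller weights
  give a larger gauge and hence a SMALLER Taylor norm ([ABKM19] Lemma 8.1, and "the trivial
  estimate `|·|_{0,X,T_φ} ≤ |·|_{0,x,T_φ}`" in the proof of Lemma 12.3);
* `norm_fieldGauge_le_mul` — gauges of two scales are comparable with the constant
  `(𝔥'/𝔥)(R/R')` (`= 2L^{-d/2}` for consecutive scales; [ABKM19] proof of Lemma 8.1);
* `isGaugeLocal_comp_gradAt` — a functional `φ ↦ f(∇φ(x))`, `x ∈ S`, is local for the gauge;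
* **`tayNorm_comp_gradAt_le`** — its Taylor norm: `‖f(∇·(x))‖_{T_φ} ≤ Σ_{s ≤ r₀} (s!)⁻¹ ‖D^s f(∇φ(x))‖ (𝔥/R)^s`
  ([ABKM19] (12.15)–(12.16): "`|𝓜_𝔦({x})|_{0,{x},T_0} ≤ … h`" and the Taylor expansion of
  `𝒦(∇φ(x))`, here with the multilinear operator norms of `D^s f`).

What is NOT here: the small-set neighbourhoods `X*` themselves (`TorusPolymers.lean`), the choice
of the parameters `h_j`, `L`, `p_Φ = ⌊d/2⌋ + 2`, `r₀` ([ABKM19] Ch. 5) and `m > 1` components.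
-- TODO(general form): `m ≥ 1` components and the Brydges–Slade variant `|ξ|^∼_{Φ,X}` (App. A.5).

## References
* S. Adams, S. Buchholz, R. Kotecký, S. Müller, arXiv:1910.13564, Ch. 6.4 (6.40)–(6.41), App. A.5,
  Lemma 12.3 [AdamsBuchholzKoteckyMuller2019].
-/

noncomputable section

namespace Literature.MathematicalPhysics.StatisticalMechanics.GradientRG

open Finset
open Literature.MathematicalPhysics.StatisticalMechanics.GradientFRD (fwdDiff iterDiff)

variable {d M : ℕ}

/-! ## Multi-indices `1 ≤ |α| ≤ p` and the linear maps `∇^α` -/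

/-- The multi-indices of the field gauge: `α : Fin d → ℕ` with `1 ≤ |α|₁ ≤ p` (each component is
then `≤ p`). [cite: AdamsBuchholzKoteckyMuller2019, Ch. 6.4 (6.40)] -/
def diffIndex (d p : ℕ) : Finset (Fin d → ℕ) :=
  (Fintype.piFinset fun _ : Fin d => Finset.range (p + 1)).filter
    fun α => 1 ≤ ∑ i, α i ∧ ∑ i, α i ≤ p

/-- Membership in `diffIndex`: exactly `1 ≤ |α|₁ ≤ p`. [cite: AdamsBuchholzKoteckyMuller2019, Ch. 6.4 (6.40)] -/
theorem mem_diffIndex {p : ℕ} {α : Fin d → ℕ} :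
    α ∈ diffIndex d p ↔ 1 ≤ ∑ i, α i ∧ ∑ i, α i ≤ p := by
  rw [diffIndex, Finset.mem_filter, Fintype.mem_piFinset]
  constructor
  · exact fun h => h.2
  · intro h
    refine ⟨fun i => Finset.mem_range.2 ?_, h⟩
    have hi : α i ≤ ∑ j, α j :=
      Finset.single_le_sum (f := α) (fun j _ => Nat.zero_le _) (Finset.mem_univ i)
    omega

/-- The unit multi-index `e_i` belongs to `diffIndex d p` for `p ≥ 1`.
[cite: AdamsBuchholzKoteckyMuller2019, Ch. 6.4 (6.40)] -/
theorem single_mem_diffIndex {p : ℕ} (hp : 1 ≤ p) (i : Fin d) :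
    (Pi.single i 1 : Fin d → ℕ) ∈ diffIndex d p := by
  rw [mem_diffIndex, Finset.sum_pi_single']
  simp only [Finset.mem_univ, if_true]
  exact ⟨le_rfl, hp⟩

/-- Iterates of `∇_i` commute with scalars. [cite: AdamsBuchholzKoteckyMuller2019, App. A.5 (discrete derivatives)] -/
theorem iterate_fwdDiff_smul (i : Fin d) (k : ℕ) (c : ℝ) (f : (Fin d → ZMod M) → ℝ) :
    (fwdDiff i)^[k] (c • f) = c • (fwdDiff i)^[k] f := by
  induction k generalizing f with
  | zero => rfl
  | succ k ih =>
    rw [Function.iterate_succ_apply, Function.iterate_succ_apply, ← ih]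
    congr 1
    funext x
    simp only [Literature.MathematicalPhysics.StatisticalMechanics.GradientFRD.fwdDiff,
      Pi.smul_apply, smul_eq_mul]
    ring

/-- `∇^α` commutes with scalars. [cite: AdamsBuchholzKoteckyMuller2019, App. A.5 (discrete derivatives)] -/
theorem iterDiff_smul (α : Fin d → ℕ) (c : ℝ) (f : (Fin d → ZMod M) → ℝ) :
    iterDiff α (c • f) = c • iterDiff α f := by
  unfold iterDiff
  induction (List.finRange d) with
  | nil => rfl
  | cons i l ih => rw [List.foldr_cons, List.foldr_cons, ih, iterate_fwdDiff_smul]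

/-- `∇^{e_i} = ∇_i`. [cite: AdamsBuchholzKoteckyMuller2019, App. A.5 (discrete derivatives)] -/
theorem iterDiff_single (i : Fin d) (f : (Fin d → ZMod M) → ℝ) :
    iterDiff (Pi.single i 1) f = fwdDiff i f := by
  have key : ∀ l : List (Fin d),
      l.foldr (fun j g => (fwdDiff j)^[(Pi.single i 1 : Fin d → ℕ) j] g) f =
        (fwdDiff i)^[l.count i] f := by
    intro l
    induction l with
    | nil => simp
    | cons j l ih =>
      rw [List.foldr_cons, ih]
      by_cases hji : j = i
      · subst hji
        rw [Pi.single_eq_same, List.count_cons_self, Function.iterate_one,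
          ← Function.iterate_succ_apply' (fwdDiff j)]
      · rw [Pi.single_eq_of_ne hji, Function.iterate_zero, id, List.count_cons_of_ne hji]
  unfold iterDiff
  rw [key, List.count_eq_one_of_mem (List.nodup_finRange d) (List.mem_finRange i)]
  rfl

/-- `∇^α` as an `ℝ`-linear map on fields. [cite: AdamsBuchholzKoteckyMuller2019, App. A.5 (discrete derivatives)] -/
def iterDiffₗ (α : Fin d → ℕ) : ((Fin d → ZMod M) → ℝ) →ₗ[ℝ] ((Fin d → ZMod M) → ℝ) where
  toFun := iterDiff α
  map_add' := iterDiff_add α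
  map_smul' := fun c f => iterDiff_smul α c f

/-- `iterDiffₗ α` is `∇^α`. [cite: AdamsBuchholzKoteckyMuller2019, App. A.5 (discrete derivatives)] -/
@[simp] theorem iterDiffₗ_apply (α : Fin d → ℕ) (f : (Fin d → ZMod M) → ℝ) :
    iterDiffₗ α f = iterDiff α f := rfl

/-! ## The field gauge `T_{j,S}` -/

/-- **The field gauge** ([ABKM19] (6.40)–(6.41), one component): the linear map
`ξ ↦ (𝔥⁻¹ R^{|α|} ∇^α ξ(x))_{x ∈ S, 1 ≤ |α| ≤ p}` into the sup-normed space of functions on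
`S × diffIndex d p`; its norm `‖T ξ‖ = max_{x∈S} max_α 𝔥⁻¹R^{|α|}|∇^αξ(x)|` is `|ξ|_{j,X}` for
`S = X*`, `𝔥 = h_j L^{-j(d-2)/2}`, `R = L^j`, `p = p_Φ`.
[cite: AdamsBuchholzKoteckyMuller2019, Ch. 6.4 (6.40)–(6.41)] -/
def fieldGauge (𝔥 R : ℝ) (p : ℕ) (S : Finset (Fin d → ZMod M)) :
    ((Fin d → ZMod M) → ℝ) →ₗ[ℝ] (S × diffIndex d p → ℝ) where
  toFun ξ q := 𝔥⁻¹ * R ^ (∑ i, (q.2 : Fin d → ℕ) i) * iterDiff (q.2 : Fin d → ℕ) ξ q.1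
  map_add' ξ η := by
    funext q
    simp only [Pi.add_apply, iterDiff_add]
    ring
  map_smul' c ξ := by
    funext q
    simp only [Pi.smul_apply, smul_eq_mul, RingHom.id_apply, iterDiff_smul]
    ring

/-- The components of the field gauge. [cite: AdamsBuchholzKoteckyMuller2019, Ch. 6.4 (6.40)] -/
theorem fieldGauge_apply (𝔥 R : ℝ) (p : ℕ) (S : Finset (Fin d → ZMod M))
    (ξ : (Fin d → ZMod M) → ℝ) (q : S × diffIndex d p) :
    fieldGauge 𝔥 R p S ξ q =
      𝔥⁻¹ * R ^ (∑ i, (q.2 : Fin d → ℕ) i) * iterDiff (q.2 : Fin d → ℕ) ξ q.1 := rfl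

/-- **Component bound**: for `x ∈ S` and `1 ≤ |α| ≤ p`,
`|∇^α ξ(x)| ≤ 𝔥 R^{-|α|} ‖T ξ‖` (the definition of the gauge as a weighted maximum).
[cite: AdamsBuchholzKoteckyMuller2019, Ch. 6.4 (6.40)] -/
theorem abs_iterDiff_le_gauge {𝔥 R : ℝ} (h𝔥 : 0 < 𝔥) (hR : 0 < R) (p : ℕ)
    {S : Finset (Fin d → ZMod M)} {x : Fin d → ZMod M} (hx : x ∈ S) {α : Fin d → ℕ}
    (hα : α ∈ diffIndex d p) (ξ : (Fin d → ZMod M) → ℝ) :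
    |iterDiff α ξ x| ≤ 𝔥 * (R ^ (∑ i, α i))⁻¹ * ‖fieldGauge 𝔥 R p S ξ‖ := by
  have hq := norm_le_pi_norm (fieldGauge 𝔥 R p S ξ) (⟨x, hx⟩, ⟨α, hα⟩)
  rw [fieldGauge_apply, Real.norm_eq_abs, abs_mul, abs_mul, abs_inv, abs_of_pos h𝔥,
    abs_of_pos (pow_pos hR _)] at hq
  have hRp : 0 < R ^ (∑ i, α i) := pow_pos hR _
  -- `𝔥⁻¹ R^{|α|} |∇^αξ(x)| ≤ ‖Tξ‖`  ⇔  `|∇^αξ(x)| ≤ 𝔥 R^{-|α|} ‖Tξ‖`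
  have : |iterDiff α ξ x| = 𝔥 * (R ^ (∑ i, α i))⁻¹ * (𝔥⁻¹ * R ^ (∑ i, α i) * |iterDiff α ξ x|) := by
    field_simp
  rw [this]
  exact mul_le_mul_of_nonneg_left hq (mul_nonneg h𝔥.le (inv_nonneg.2 hRp.le))

/-- The gradient vector at a site: `gradAt x ξ = (∇_i ξ(x))_{i < d} ∈ ℝ^d`, a linear map.
[cite: AdamsBuchholzKoteckyMuller2019, Ch. 6.2 (the gradients ∇_i φ(x))] -/
def gradAt (x : Fin d → ZMod M) : ((Fin d → ZMod M) → ℝ) →ₗ[ℝ] (Fin d → ℝ) where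
  toFun ξ i := fwdDiff i ξ x
  map_add' ξ η := by
    funext i
    simp only [Pi.add_apply, fwdDiff_add]
  map_smul' c ξ := by
    funext i
    simp only [Pi.smul_apply, smul_eq_mul, RingHom.id_apply,
      Literature.MathematicalPhysics.StatisticalMechanics.GradientFRD.fwdDiff]
    ring

/-- The components of `gradAt`. [cite: AdamsBuchholzKoteckyMuller2019, Ch. 6.2 (the gradients ∇_i φ(x))] -/
@[simp] theorem gradAt_apply (x : Fin d → ZMod M) (ξ : (Fin d → ZMod M) → ℝ) (i : Fin d) :
    gradAt x ξ i = fwdDiff i ξ x := rfl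

/-- **The gradient at a site of `S` is bounded by the gauge**: `‖∇ξ(x)‖_∞ ≤ (𝔥/R) ‖T ξ‖`
(`p ≥ 1`; [ABKM19] (12.16): "`|∇_i ψ̇(x)| ≤ … h |ψ̇|_{0,{x}}`", at scale `0` where `𝔥 = h`, `R = 1`).
[cite: AdamsBuchholzKoteckyMuller2019, Lemma 12.3 (12.16)] -/
theorem norm_gradAt_le_gauge {𝔥 R : ℝ} (h𝔥 : 0 < 𝔥) (hR : 0 < R) {p : ℕ} (hp : 1 ≤ p)
    {S : Finset (Fin d → ZMod M)} {x : Fin d → ZMod M} (hx : x ∈ S)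
    (ξ : (Fin d → ZMod M) → ℝ) :
    ‖gradAt x ξ‖ ≤ 𝔥 / R * ‖fieldGauge 𝔥 R p S ξ‖ := by
  refine (pi_norm_le_iff_of_nonneg (mul_nonneg (div_nonneg h𝔥.le hR.le) (norm_nonneg _))).2
    fun i => ?_
  rw [gradAt_apply, Real.norm_eq_abs, ← iterDiff_single]
  have h := abs_iterDiff_le_gauge h𝔥 hR p hx (single_mem_diffIndex hp i) ξ
  rw [Finset.sum_pi_single'] at h
  simp only [Finset.mem_univ, if_true, pow_one] at h
  rwa [div_eq_mul_inv]


/-! ## Comparison of gauges: more sites / smaller weights give a larger gauge ([ABKM19] Ch. 8.1) -/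

/-- **Monotonicity in the site set**: `S ⊆ S'` gives `‖T_S ξ‖ ≤ ‖T_{S'} ξ‖` (the maximum runs over
more sites). [cite: AdamsBuchholzKoteckyMuller2019, Ch. 6.4 (6.40)] -/
theorem norm_fieldGauge_mono_set (𝔥 R : ℝ) (p : ℕ) {S S' : Finset (Fin d → ZMod M)}
    (hSS' : S ⊆ S') (ξ : (Fin d → ZMod M) → ℝ) :
    ‖fieldGauge 𝔥 R p S ξ‖ ≤ ‖fieldGauge 𝔥 R p S' ξ‖ := by
  refine (pi_norm_le_iff_of_nonneg (norm_nonneg _)).2 fun q => ?_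
  have h := norm_le_pi_norm (fieldGauge 𝔥 R p S' ξ) (⟨q.1, hSS' q.1.2⟩, q.2)
  rw [fieldGauge_apply] at h ⊢
  exact h

/-- **Monotonicity in the weights**: if `0 < 𝔥' ≤ 𝔥` and `0 < R ≤ R'` then
`‖T_{𝔥,R} ξ‖ ≤ ‖T_{𝔥',R'} ξ‖` (componentwise `𝔥⁻¹R^{|α|} ≤ 𝔥'⁻¹R'^{|α|}`); with
`𝔥 = h_k L^{-k(d-2)/2}`, `R = L^k` this is `|ξ|_{k,X} ≤ |ξ|_{k+1,X}` for `L ≥ 2`.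
[cite: AdamsBuchholzKoteckyMuller2019, Ch. 6.4 (6.41)] -/
theorem norm_fieldGauge_mono_weights {𝔥 𝔥' R R' : ℝ} (h𝔥' : 0 < 𝔥') (h𝔥𝔥' : 𝔥' ≤ 𝔥)
    (hR : 0 < R) (hRR' : R ≤ R') (p : ℕ) (S : Finset (Fin d → ZMod M))
    (ξ : (Fin d → ZMod M) → ℝ) :
    ‖fieldGauge 𝔥 R p S ξ‖ ≤ ‖fieldGauge 𝔥' R' p S ξ‖ := by
  refine (pi_norm_le_iff_of_nonneg (norm_nonneg _)).2 fun q => ?_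
  have h := norm_le_pi_norm (fieldGauge 𝔥' R' p S ξ) q
  refine le_trans ?_ h
  rw [fieldGauge_apply, fieldGauge_apply, Real.norm_eq_abs, Real.norm_eq_abs, abs_mul, abs_mul,
    abs_mul, abs_mul, abs_inv, abs_inv, abs_of_pos (h𝔥'.trans_le h𝔥𝔥'), abs_of_pos h𝔥',
    abs_of_pos (pow_pos hR _), abs_of_pos (pow_pos (hR.trans_le hRR') _)]
  have h1 : 𝔥⁻¹ ≤ 𝔥'⁻¹ := inv_anti₀ h𝔥' h𝔥𝔥'
  have h2 : R ^ (∑ i, (q.2 : Fin d → ℕ) i) ≤ R' ^ (∑ i, (q.2 : Fin d → ℕ) i) :=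
    pow_le_pow_left₀ hR.le hRR' _
  gcongr

/-! ## Single-site functionals `φ ↦ f(∇φ(x))` -/

variable {𝔸 : Type*} [NormedRing 𝔸] [NormedAlgebra ℝ 𝔸]

omit [NormedRing 𝔸] [NormedAlgebra ℝ 𝔸] in
/-- A functional of the gradient at a site of `S` is local for the gauge `T_{j,S}` (`p ≥ 1`).
[cite: AdamsBuchholzKoteckyMuller2019, Lemma 12.3 (I(𝒦) is local)] -/
theorem isGaugeLocal_comp_gradAt [NeZero M] {𝔥 R : ℝ} (h𝔥 : 0 < 𝔥) (hR : 0 < R) {p : ℕ} (hp : 1 ≤ p)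
    {S : Finset (Fin d → ZMod M)} {x : Fin d → ZMod M} (hx : x ∈ S) (f : (Fin d → ℝ) → 𝔸) :
    IsGaugeLocal (fieldGauge 𝔥 R p S) (fun φ => f (gradAt x φ)) :=
  IsGaugeLocal.of_factor (gradAt x) (fun ξ => norm_gradAt_le_gauge h𝔥 hR hp hx ξ) f

/-- **Taylor norm of a single-site functional** ([ABKM19] (12.15)–(12.17), the heart of Lemma 12.3,
with multilinear operator norms): for `f ∈ C^{r₀}(ℝ^d; 𝔸)` and `x ∈ S`,
`‖f(∇·(x))‖_{T_φ} ≤ Σ_{s ≤ r₀} (s!)⁻¹ ‖D^s f(∇φ(x))‖ (𝔥/R)^s`.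
[cite: AdamsBuchholzKoteckyMuller2019, Lemma 12.3 (12.15)–(12.17)] -/
theorem tayNorm_comp_gradAt_le [NeZero M] {𝔥 R : ℝ} (h𝔥 : 0 < 𝔥) (hR : 0 < R) {p : ℕ}
    (hp : 1 ≤ p) {S : Finset (Fin d → ZMod M)} {x : Fin d → ZMod M} (hx : x ∈ S) {r₀ : ℕ}
    {f : (Fin d → ℝ) → 𝔸} (hf : ContDiff ℝ r₀ f) (φ : (Fin d → ZMod M) → ℝ) :
    tayNorm (fieldGauge 𝔥 R p S) r₀ (fun φ => f (gradAt x φ)) φ ≤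
      ∑ s ∈ Finset.range (r₀ + 1),
        ((s.factorial : ℝ)⁻¹) * (‖iteratedFDeriv ℝ s f (gradAt x φ)‖ * (𝔥 / R) ^ s) :=
  tayNorm_le_of_factor (fieldGauge 𝔥 R p S) (gradAt x) (div_nonneg h𝔥.le hR.le)
    (fun ξ => norm_gradAt_le_gauge h𝔥 hR hp hx ξ) hf (fun _ => rfl) φ

/-- **A larger site set gives a smaller Taylor norm** ("the trivial estimate
`|·|_{0,X,T_φ} ≤ |·|_{0,x,T_φ}` whenever `x ∈ X`", [ABKM19] proof of Lemma 12.3): for `S ⊆ S'` and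
`F` local with respect to `T_S`, `‖F‖_{T_φ}^{(S')} ≤ ‖F‖_{T_φ}^{(S)}`.
[cite: AdamsBuchholzKoteckyMuller2019, Lemma 12.3 (proof, after (12.17))] -/
theorem tayNorm_fieldGauge_anti_set [NeZero M] (𝔥 R : ℝ) (p : ℕ) {S S' : Finset (Fin d → ZMod M)}
    (hSS' : S ⊆ S') {r₀ : ℕ} {F : ((Fin d → ZMod M) → ℝ) → 𝔸} (hF : ContDiff ℝ r₀ F)
    (hloc : IsGaugeLocal (fieldGauge 𝔥 R p S) F) (φ : (Fin d → ZMod M) → ℝ) :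
    tayNorm (fieldGauge 𝔥 R p S') r₀ F φ ≤ tayNorm (fieldGauge 𝔥 R p S) r₀ F φ :=
  tayNorm_mono_gauge _ _ (fun ξ => norm_fieldGauge_mono_set 𝔥 R p hSS' ξ) hF hloc φ

/-- **Larger weights give a smaller Taylor norm** (the mechanism of [ABKM19] Lemma 8.1,
`|F|_{k+1,X,T_φ} ≤ |F|_{k,X,T_φ}`): if `0 < 𝔥' ≤ 𝔥`, `0 < R ≤ R'` and `F` is `T_{𝔥,R}`-local, then
`‖F‖_{T_φ}^{(𝔥',R')} ≤ ‖F‖_{T_φ}^{(𝔥,R)}`. [cite: AdamsBuchholzKoteckyMuller2019, Lemma 8.1] -/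
theorem tayNorm_fieldGauge_anti_weights [NeZero M] {𝔥 𝔥' R R' : ℝ} (h𝔥' : 0 < 𝔥')
    (h𝔥𝔥' : 𝔥' ≤ 𝔥) (hR : 0 < R) (hRR' : R ≤ R') (p : ℕ) (S : Finset (Fin d → ZMod M))
    {r₀ : ℕ} {F : ((Fin d → ZMod M) → ℝ) → 𝔸} (hF : ContDiff ℝ r₀ F)
    (hloc : IsGaugeLocal (fieldGauge 𝔥 R p S) F) (φ : (Fin d → ZMod M) → ℝ) :
    tayNorm (fieldGauge 𝔥' R' p S) r₀ F φ ≤ tayNorm (fieldGauge 𝔥 R p S) r₀ F φ :=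
  tayNorm_mono_gauge _ _ (fun ξ => norm_fieldGauge_mono_weights h𝔥' h𝔥𝔥' hR hRR' p S ξ) hF hloc φ

/-! ## Comparison of the gauges of two scales with a constant ([ABKM19] proof of Lemma 8.1) -/

/-- **The gauges of two scales are comparable**: for `0 < 𝔥, 𝔥'` and `0 < R ≤ R'`,
`‖T_{𝔥,R} ξ‖ ≤ (𝔥'/𝔥)(R/R') · ‖T_{𝔥',R'} ξ‖` (componentwise `𝔥⁻¹R^{|α|} ≤ (𝔥'/𝔥)(R/R')^{|α|} 𝔥'⁻¹R'^{|α|}`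
and `|α| ≥ 1`).  For consecutive scales of [ABKM19] (`𝔥' = 2L^{-(d-2)/2}𝔥`, `R' = LR`) the constant is
`ρ = 2L^{-d/2}`: "`|g^{(r)}|_{k,X} ≤ 2^r L^{-r d/2} |g^{(r)}|_{k+1,X}`".
[cite: AdamsBuchholzKoteckyMuller2019, Lemma 8.1 (proof)] -/
theorem norm_fieldGauge_le_mul {𝔥 𝔥' R R' : ℝ} (h𝔥 : 0 < 𝔥) (h𝔥' : 0 < 𝔥') (hR : 0 < R)
    (hRR' : R ≤ R') (p : ℕ) (S : Finset (Fin d → ZMod M)) (ξ : (Fin d → ZMod M) → ℝ) :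
    ‖fieldGauge 𝔥 R p S ξ‖ ≤ 𝔥' / 𝔥 * (R / R') * ‖fieldGauge 𝔥' R' p S ξ‖ := by
  have hR' : 0 < R' := hR.trans_le hRR'
  have hρ : 0 ≤ 𝔥' / 𝔥 * (R / R') := by positivity
  refine (pi_norm_le_iff_of_nonneg (mul_nonneg hρ (norm_nonneg _))).2 fun q => ?_
  have h := norm_le_pi_norm (fieldGauge 𝔥' R' p S ξ) q
  obtain ⟨hn1, -⟩ := mem_diffIndex.1 q.2.2
  rw [fieldGauge_apply, Real.norm_eq_abs] at h ⊢
  rw [abs_mul, abs_mul, abs_inv, abs_of_pos h𝔥', abs_of_pos (pow_pos hR' _)] at h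
  rw [abs_mul, abs_mul, abs_inv, abs_of_pos h𝔥, abs_of_pos (pow_pos hR _)]
  -- `𝔥⁻¹ Rⁿ |D| = (𝔥'/𝔥) (R/R')ⁿ · (𝔥'⁻¹ R'ⁿ |D|)`
  have key : 𝔥⁻¹ * R ^ (∑ i, (q.2 : Fin d → ℕ) i) * |iterDiff (q.2 : Fin d → ℕ) ξ q.1| =
      𝔥' / 𝔥 * (R / R') ^ (∑ i, (q.2 : Fin d → ℕ) i) *
        (𝔥'⁻¹ * R' ^ (∑ i, (q.2 : Fin d → ℕ) i) * |iterDiff (q.2 : Fin d → ℕ) ξ q.1|) := by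
    rw [div_pow]
    field_simp
  rw [key]
  have hrr : (R / R') ^ (∑ i, (q.2 : Fin d → ℕ) i) ≤ R / R' := by
    conv_rhs => rw [← pow_one (R / R')]
    exact pow_le_pow_of_le_one (div_nonneg hR.le hR'.le) ((div_le_one hR').2 hRR') hn1
  have hnn : 0 ≤ 𝔥'⁻¹ * R' ^ (∑ i, (q.2 : Fin d → ℕ) i) * |iterDiff (q.2 : Fin d → ℕ) ξ q.1| := by
    positivity
  calc 𝔥' / 𝔥 * (R / R') ^ (∑ i, (q.2 : Fin d → ℕ) i) *
        (𝔥'⁻¹ * R' ^ (∑ i, (q.2 : Fin d → ℕ) i) * |iterDiff (q.2 : Fin d → ℕ) ξ q.1|)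
      ≤ 𝔥' / 𝔥 * (R / R') *
        (𝔥'⁻¹ * R' ^ (∑ i, (q.2 : Fin d → ℕ) i) * |iterDiff (q.2 : Fin d → ℕ) ξ q.1|) := by
        gcongr
    _ ≤ 𝔥' / 𝔥 * (R / R') * ‖fieldGauge 𝔥' R' p S ξ‖ := mul_le_mul_of_nonneg_left h hρ

end Literature.MathematicalPhysics.StatisticalMechanics.GradientRG

end
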